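import Summits.Ventures.WeilGRH.TwistedSechTableHalf
import HarnessLib

/-!
# GRH arm (rh-explicit, venture WeilGRH): kernel checkers of literal `sech` tables, v2 (half-term boxes)

Cell `rh-explicit`, WEIL TRACK — GRH ARM (engine seat weil-grh-2 gen9).  The v2 twin of `TwistedSechTableCheck.lean`:
a literal sine table `stab` (`I_n`, `n < N`) and a literal diagonal table `dtab` (`sechIncrCoeff a n n`, `n < B`) are
validated by re-computation in the kernel against `SechEncl.sinBoxH` / `SechEncl.diagBoxH`
(`TwistedSechTableHalf.lean`) on a MODE RANGE `n0 ≤ n < n1` (so a long table can be certified across several light files):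
`checkSinTabH` / `checkDiagTabH` with `sinTabValid_of_checkH` / `diagTabValid_of_checkH`, whose conclusions (for `n0 = 0`)
are those of gen8's `sinTabValid_of_check` / `diagTabValid_of_check` — the cell checker `TwistedGramCellCheckH.lean` consumes
either.  Everything is PROVED; computable `def`s with docstrings; no named facts;
RH/GRH-free; standard axioms.  References: R. E. Moore (1966) Ch. 3 [Moore1966].
-/

set_option autoImplicit false

open Real MeasureTheory Set
open scoped BigOperators

namespace Summit.Ventures.WeilGRH

open Literature.Analysis.ValidatedNumerics.NumericsMP

/-! ## Kernel checkers of literal tables (v2) — same validity conclusions as `TwistedSechTableCheck` -/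

namespace TwistedEncl

variable {S : ℕ} {a : ℝ}

/-- Kernel checker of a literal sine table against `SechEncl.sinBoxH` on the mode range `n0 ≤ n < n1`
(so a long table can be validated in several files). [cite: Moore1966, Ch. 3 (interval arithmetic: inclusion property)] -/
def checkSinTabH (S : ℕ) (P A E0 R : MI) (K n0 n1 : ℕ) (stab : List MI) : Bool :=
  (List.range (n1 - n0)).all fun i ↦
    match SechEncl.omegaBox S P A (n0 + i) with
    | some Ω => decide (SechEncl.sinBoxH S Ω E0 R K = some (stab.getD (n0 + i) default))
    | none => false

/-- `checkSinTabH = true` ⇒ the sine table is valid on `n0 ≤ n < n1`. [cite: Moore1966, Ch. 3 (interval arithmetic: inclusion property)] -/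
theorem sinTabValid_of_checkH (hS : 0 < S) (ha : 0 < a) {P A E0 R : MI} (hP : MI.mem S Real.pi P) (hA : MI.mem S a A)
    (hE0 : MI.mem S (Real.exp (-a)) E0) (hR : MI.mem S (Real.exp (-(2 * a))) R) {K n0 n1 : ℕ} {stab : List MI}
    (h : checkSinTabH S P A E0 R K n0 n1 stab = true) :
    ∀ n : ℕ, n0 ≤ n → n < n1 →
      MI.mem S (∫ t in Ioc 0 (2 * a), 1 / (2 * Real.cosh (t / 2)) * Real.sin (π * n / a * t)) (stab.getD n default) := by
  intro n hn0 hn1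
  unfold checkSinTabH at h
  simp only [List.all_eq_true, List.mem_range] at h
  have hn' := h (n - n0) (by omega)
  rw [show n0 + (n - n0) = n by omega] at hn'
  split at hn'
  · rename_i Ω hΩ
    simp only [decide_eq_true_eq] at hn'
    exact SechEncl.mem_sinBoxH hS ha hP hA hΩ hE0 hR hn'
  · simp at hn'

/-- Kernel checker of a literal diagonal table against `SechEncl.diagBoxH` on the mode range `n0 ≤ n < n1`.
[cite: Moore1966, Ch. 3 (interval arithmetic: inclusion property)] -/
def checkDiagTabH (S Karc : ℕ) (P A EA E0 R : MI) (K n0 n1 : ℕ) (dtab : List MI) : Bool :=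
  (List.range (n1 - n0)).all fun i ↦
    match SechEncl.omegaBox S P A (n0 + i) with
    | some Ω => decide (SechEncl.diagBoxH S Karc P A EA Ω E0 R K = some (dtab.getD (n0 + i) default))
    | none => false

/-- `checkDiagTabH = true` ⇒ the diagonal table is valid on `n0 ≤ n < n1`. [cite: Moore1966, Ch. 3 (interval arithmetic: inclusion property)] -/
theorem diagTabValid_of_checkH (hS : 0 < S) (ha : 0 < a) {Karc : ℕ} {P A EA E0 R : MI} (hP : MI.mem S Real.pi P)
    (hA : MI.mem S a A) (hEA : MI.mem S (Real.exp a) EA) (hE0 : MI.mem S (Real.exp (-a)) E0)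
    (hR : MI.mem S (Real.exp (-(2 * a))) R) {K n0 n1 : ℕ} {dtab : List MI}
    (h : checkDiagTabH S Karc P A EA E0 R K n0 n1 dtab = true) :
    ∀ n : ℕ, n0 ≤ n → n < n1 → MI.mem S (sechIncrCoeff a n n) (dtab.getD n default) := by
  intro n hn0 hn1
  unfold checkDiagTabH at h
  simp only [List.all_eq_true, List.mem_range] at h
  have hn' := h (n - n0) (by omega)
  rw [show n0 + (n - n0) = n by omega] at hn'
  split at hn'
  · rename_i Ω hΩ
    simp only [decide_eq_true_eq] at hn'
    exact SechEncl.mem_diagBoxH hS ha hP hA hEA hΩ hE0 hR hn'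
  · simp at hn'

end TwistedEncl

end Summit.Ventures.WeilGRH
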